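import Summits.QuantumFields.BalabanUV.Beta.FP.TowerK2bDoorTadpoleMoments

/-!
# `BalabanUV.Beta.FP.TowerK2bDoorReadoutMoments` — binder row D1 ∕ (C1) OWNER «beta-an2», PART 42: **A CO-CLOSED, REFLECTION-EVEN, FINITELY SUPPORTED
# LATTICE 1-FORM HAS NO ZEROTH AND NO FIRST MOMENT IN ANY COMPONENT; HENCE THE LATTICE FIRST AND SECOND MOMENTS OF THE DOOR PAIRING VANISH** (the
# read-out column `Ŝ` of SPEC-64's door tadpole — K1 §6 «the φ-column is coarse co-closed»; PREDICTION-AN2-75-Z's mechanism in kernel letters over PART 41)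

WHY.  PART 41 (`TowerK2bDoorTadpoleMoments`) writes the lattice first∕second moments of the covariant symmetrised door pairing `X = Ŝ ⋆ τ(λ)` as bilinear forms in
the factor moments; with `Θ = 0` (no door word on the summed gauge column — LOCATED: K2L-LAM, LEMMA U) what survives is `M0Ŝ·M1τ`, `M0Ŝ·M2τ` and `M1Ŝ ⊗ M1τ`.  This
file supplies the two record-side facts about the READ-OUT column `Ŝ` (a lattice 1-form `A κ y`: component `κ`, position `y`, supported in a window `W`) that kill
`M0Ŝ` and `M1Ŝ`, as discrete integrations by parts, hypothesis-displayed: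
§1 **`sum_mul_latticeDiv_eq`** — SUMMATION BY PARTS: `Σ_{y∈Y} f y·Σ_κ (A κ y − A κ (y − e_κ)) = Σ_κ Σ_{w∈W} (f w − f (w + e_κ))·A κ w` for any test function `f`
   (`Y ⊇ W ∪ (W + e_κ)`); **`sum_shiftDiff_mul_eq_zero_of_coclosed`** — if `A` is CO-CLOSED on `Y` (`Σ_κ (A κ y − A κ (y − e_κ)) = 0`) the right side vanishes for EVERY `f`;
§2 with `f` ADDITIVE (`c : G →+ ℝ`): **`sum_weight_colSum_eq_zero_of_coclosed`** (`Σ_κ c(e_κ)·M0(A κ) = 0`) and, at a lattice coordinate (`c(e_κ) = [κ = μ]`),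
   **`colSum_eq_zero_of_coclosed`** — `M0(A μ) = 0` for EVERY component (PART 41's letter `hS0`); with `f = c·c′` a product of additive maps:
   **`sum_weight_firstMoments_eq_zero_of_coclosed`**, whence **`longitudinalDipole_eq_zero_of_coclosed`** (`Σ_w c_μ w·A μ w = 0`) and
   **`transverseDipoles_antisymm_of_coclosed`** (`Σ_w c_μ w·A ν w = −Σ_w c_ν w·A μ w`, `μ ≠ ν`);
§3 **`firstMoment_eq_zero_of_reflect`** — if a window-preserving bijection `R` leaves the component `A κ` invariant and flips the weight (`c (R w) = k − c w`) then
   `2·Σ_w c w·A κ w = k·M0(A κ)`, so the dipole vanishes with the column sum; **`dipoles_eq_zero_of_coclosed_of_reflect`** — THE PACKAGE: co-closed + one such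
   reflection for every moment direction `ρ ≠ ν` (the source's own direction excepted) acting evenly on every component `κ ≠ ρ` ⇒ `Σ_w c_ρ w·A κ w = 0` for ALL
   `(ρ, κ)` (cases: `κ = ρ` longitudinal by §2; `ρ ≠ κ, ρ ≠ ν` by reflection; `ρ = ν ≠ κ` by antisymmetry + reflection in `κ`);
§4 JUNCTION TO PART 41: **`latticeFirstMoment_symPairing_eq_zero_of_colSums_eq_zero`** (`hΘ ∧ hS0 ⇒ Σ_z c z·X = 0` for EVERY source pair, not only the diagonal) and
   **`latticeSecondMoment_symPairing_eq_zero_of_dipoles_eq_zero`** (`hΘ ∧ hS0 ∧` all read-out dipoles zero ⇒ `Σ_z c z·c′ z·X = 0` — every component, the (1.22)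
   read-out line included); `HasSum` twins.
READING (zero weight; nothing asserted about the record): the letters are by value ∕ by symmetry for Engine C's objects (co-closedness: K1 §6 at depth 1; reflections:
centred blocks, roots and comb order are mirror-symmetric) and are READ on the K2L-M2P7 deposit (`wPhi9` persisted); at p = 4 every periodised second moment of
the deposit is already cancelled to ≥ 97 % of its absolute scale (`gen75/cert/m2p7/cancellation_p4.txt`).  [folklore] `Finset` algebra BY NAME over an abstract additive
commutative group with displayed unit steps `e : D → G`; no `def`, no `def … : Prop`, nothing cited, 0 sorry; imports PART 41 only.  Nothing of Bałaban's asserted,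
valued or discharged; `hD1 ∕ hD2 ∕ hDF` NOT discharged at the record's letters (co-closedness, reflection parities, supports, `hΘ` DISPLAYED); `hDΔ ∕ hDΔtr ∕ D1Tel` NOT
claimed either way; (J-R₂″) NOT claimed; 0∕4 row-D1 binders (hW ∕ hR ∕ D1Tel ∕ D1Rep); NOT (C1), NOT (T-ID), NOT D1, NEVER «G-an2-4 closed», NOT BetaPertH, NOT continuum,
NOT Clay.
HONEST DEPENDENCY (page 1, mandatory): continuum YM on T⁴ ⇐ BetaPertH ∧ nine spine estimates (0/9 proved); BetaPertH ⇐ (D1) ∧ (D4) ∧ CAP+tail;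
G-an2-4 gates asym, D1 and NE2/3/4.  HONEST FRAMING (cell contract, verbatim): «discharging `BetaPertH` makes Bałaban's UV stability UNCONDITIONAL —
a real constructive-QFT result; it is NOT the continuum limit and NOT the Clay problem.»  ABSOLUTE RULE (cell charter, verbatim): «No internally-minted
statement may enter as a cited fact. Every hypothesis is either kernel-proved in this package or a verbatim quotation of a PUBLISHED theorem with page
reference. The manuscript(s) under audit are NOT citable for their own disputed steps — they are the thing under adjudication; programme-internal
(2001/route/tribunal) claims are never citable.»  Row D1 ∕ (C1) OWNER, b2b-balaban-beta-an2 gen 75, 2026-08-28.  No existing file touched.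
-/

noncomputable section

open scoped BigOperators

namespace Summit.QuantumFields.BalabanUV.Beta.FP.TowerK2bDoorReadoutMoments

open Finset
open Summit.QuantumFields.BalabanUV.Beta.FP.TowerK2bDoorTadpoleMoments
  (latticeFirstMoment_symPairing_eq_of_colSum_eq_zero latticeSecondMoment_symPairing_eq_of_colSums_eq_zero hasSum_weighted_symPairing)

variable {D G : Type*} [Fintype D] [AddCommGroup G] [DecidableEq G]

/-! ## §1 Summation by parts against the lattice divergence -/

/-- [folklore] **`sum_mul_latticeDiv_eq` — SUMMATION BY PARTS**: for a lattice 1-form `A` (component `κ`, position `y`) supported in the window `W`, unit steps `e κ`,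
and a summation domain `Y` containing `W` and every `w + e κ`, `w ∈ W`:  `Σ_{y∈Y} f y·Σ_κ (A κ y − A κ (y − e κ)) = Σ_κ Σ_{w∈W} (f w − f (w + e κ))·A κ w`. -/
theorem sum_mul_latticeDiv_eq (e : D → G) (A : D → G → ℝ) (W Y : Finset G) (hAW : ∀ (κ : D) (w : G), w ∉ W → A κ w = 0)
    (hWY : ∀ w ∈ W, w ∈ Y) (hWY' : ∀ (κ : D), ∀ w ∈ W, w + e κ ∈ Y) (f : G → ℝ) :
    ∑ y ∈ Y, f y * ∑ κ, (A κ y - A κ (y - e κ)) = ∑ κ, ∑ w ∈ W, (f w - f (w + e κ)) * A κ w := by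
  simp only [Finset.mul_sum]
  rw [Finset.sum_comm]
  refine Finset.sum_congr rfl fun κ _ => ?_
  simp only [mul_sub, Finset.sum_sub_distrib, sub_mul]
  congr 1
  · symm
    exact Finset.sum_subset (fun w hw => hWY w hw) fun y _ hy => by rw [hAW κ y hy, mul_zero]
  · have hinj : Set.InjOn (fun y : G => y - e κ) (Y : Set G) := fun a _ b _ (h : a - e κ = b - e κ) => sub_left_injective h
    have h1 : ∑ y ∈ Y, f y * A κ (y - e κ) = ∑ w ∈ Y.image (fun y => y - e κ), f (w + e κ) * A κ w := by
      rw [Finset.sum_image hinj]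
      exact Finset.sum_congr rfl fun y _ => by rw [sub_add_cancel]
    rw [h1]
    symm
    refine Finset.sum_subset (fun w hw => Finset.mem_image.mpr ⟨w + e κ, hWY' κ w hw, add_sub_cancel_right w (e κ)⟩) fun w _ hw => ?_
    rw [hAW κ w hw, mul_zero]

/-- [folklore] **`sum_shiftDiff_mul_eq_zero_of_coclosed`**: if `A` is CO-CLOSED on `Y` (`Σ_κ (A κ y − A κ (y − e κ)) = 0` for `y ∈ Y`) then for EVERY test function `f`,
`Σ_κ Σ_{w∈W} (f w − f (w + e κ))·A κ w = 0`. -/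
theorem sum_shiftDiff_mul_eq_zero_of_coclosed (e : D → G) (A : D → G → ℝ) (W Y : Finset G) (hAW : ∀ (κ : D) (w : G), w ∉ W → A κ w = 0)
    (hWY : ∀ w ∈ W, w ∈ Y) (hWY' : ∀ (κ : D), ∀ w ∈ W, w + e κ ∈ Y) (hdiv : ∀ y ∈ Y, ∑ κ, (A κ y - A κ (y - e κ)) = 0) (f : G → ℝ) :
    ∑ κ, ∑ w ∈ W, (f w - f (w + e κ)) * A κ w = 0 := by
  rw [← sum_mul_latticeDiv_eq e A W Y hAW hWY hWY' f]
  exact Finset.sum_eq_zero fun y hy => by rw [hdiv y hy, mul_zero]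

/-! ## §2 Additive and product test functions: column sums and dipoles of a co-closed form -/

/-- [folklore] **`sum_weight_colSum_eq_zero_of_coclosed`** (`f` additive): `Σ_κ c(e κ)·(Σ_{w∈W} A κ w) = 0` for every additive `c : G →+ ℝ`. -/
theorem sum_weight_colSum_eq_zero_of_coclosed (e : D → G) (A : D → G → ℝ) (W Y : Finset G) (hAW : ∀ (κ : D) (w : G), w ∉ W → A κ w = 0)
    (hWY : ∀ w ∈ W, w ∈ Y) (hWY' : ∀ (κ : D), ∀ w ∈ W, w + e κ ∈ Y) (hdiv : ∀ y ∈ Y, ∑ κ, (A κ y - A κ (y - e κ)) = 0) (c : G →+ ℝ) :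
    ∑ κ, c (e κ) * ∑ w ∈ W, A κ w = 0 := by
  have h := sum_shiftDiff_mul_eq_zero_of_coclosed e A W Y hAW hWY hWY' hdiv c
  have h' : ∑ κ, ∑ w ∈ W, ((c : G → ℝ) w - c (w + e κ)) * A κ w = -∑ κ, c (e κ) * ∑ w ∈ W, A κ w := by
    rw [← Finset.sum_neg_distrib]
    refine Finset.sum_congr rfl fun κ _ => ?_
    rw [Finset.mul_sum, ← Finset.sum_neg_distrib]
    exact Finset.sum_congr rfl fun w _ => by rw [map_add]; ring
  rw [h'] at h
  exact neg_eq_zero.mp h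

/-- [folklore] **`colSum_eq_zero_of_coclosed`** — PART 41's letter `hS0` FROM CO-CLOSEDNESS: at a lattice coordinate `c` of direction `μ` (`c (e κ) = [κ = μ]`) the
column sum of the `μ`-component vanishes: `Σ_{w∈W} A μ w = 0`. -/
theorem colSum_eq_zero_of_coclosed [DecidableEq D] (e : D → G) (A : D → G → ℝ) (W Y : Finset G) (hAW : ∀ (κ : D) (w : G), w ∉ W → A κ w = 0)
    (hWY : ∀ w ∈ W, w ∈ Y) (hWY' : ∀ (κ : D), ∀ w ∈ W, w + e κ ∈ Y) (hdiv : ∀ y ∈ Y, ∑ κ, (A κ y - A κ (y - e κ)) = 0)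
    (c : G →+ ℝ) (μ : D) (hc : ∀ κ, c (e κ) = if κ = μ then 1 else 0) :
    ∑ w ∈ W, A μ w = 0 := by
  have h := sum_weight_colSum_eq_zero_of_coclosed e A W Y hAW hWY hWY' hdiv c
  simp only [hc, ite_mul, one_mul, zero_mul, Finset.sum_ite_eq', Finset.mem_univ, if_true] at h
  exact h

/-- [folklore] **`sum_weight_firstMoments_eq_zero_of_coclosed`** (`f = c·c′`, two additive maps):
`Σ_κ (c′(e κ)·Σ_w c w·A κ w + c(e κ)·Σ_w c′ w·A κ w + c(e κ)·c′(e κ)·Σ_w A κ w) = 0`. -/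
theorem sum_weight_firstMoments_eq_zero_of_coclosed (e : D → G) (A : D → G → ℝ) (W Y : Finset G) (hAW : ∀ (κ : D) (w : G), w ∉ W → A κ w = 0)
    (hWY : ∀ w ∈ W, w ∈ Y) (hWY' : ∀ (κ : D), ∀ w ∈ W, w + e κ ∈ Y) (hdiv : ∀ y ∈ Y, ∑ κ, (A κ y - A κ (y - e κ)) = 0) (c c' : G →+ ℝ) :
    ∑ κ, (c' (e κ) * ∑ w ∈ W, c w * A κ w + c (e κ) * ∑ w ∈ W, c' w * A κ w + c (e κ) * c' (e κ) * ∑ w ∈ W, A κ w) = 0 := by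
  have h := sum_shiftDiff_mul_eq_zero_of_coclosed e A W Y hAW hWY hWY' hdiv (fun w => c w * c' w)
  have h' : ∑ κ, ∑ w ∈ W, (c w * c' w - c (w + e κ) * c' (w + e κ)) * A κ w
      = -∑ κ, (c' (e κ) * ∑ w ∈ W, c w * A κ w + c (e κ) * ∑ w ∈ W, c' w * A κ w + c (e κ) * c' (e κ) * ∑ w ∈ W, A κ w) := by
    rw [← Finset.sum_neg_distrib]
    refine Finset.sum_congr rfl fun κ _ => ?_
    rw [Finset.mul_sum, Finset.mul_sum, Finset.mul_sum, ← Finset.sum_add_distrib, ← Finset.sum_add_distrib, ← Finset.sum_neg_distrib]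
    exact Finset.sum_congr rfl fun w _ => by rw [map_add, map_add]; ring
  rw [h'] at h
  exact neg_eq_zero.mp h

/-- [folklore] **`longitudinalDipole_eq_zero_of_coclosed`**: at a lattice coordinate `c` of direction `μ`, the LONGITUDINAL dipole of a co-closed form vanishes:
`Σ_{w∈W} c w·A μ w = 0` (from `2·M1 + M0 = 0` and `M0 = 0`). -/
theorem longitudinalDipole_eq_zero_of_coclosed [DecidableEq D] (e : D → G) (A : D → G → ℝ) (W Y : Finset G) (hAW : ∀ (κ : D) (w : G), w ∉ W → A κ w = 0)
    (hWY : ∀ w ∈ W, w ∈ Y) (hWY' : ∀ (κ : D), ∀ w ∈ W, w + e κ ∈ Y) (hdiv : ∀ y ∈ Y, ∑ κ, (A κ y - A κ (y - e κ)) = 0)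
    (c : G →+ ℝ) (μ : D) (hc : ∀ κ, c (e κ) = if κ = μ then 1 else 0) :
    ∑ w ∈ W, c w * A μ w = 0 := by
  have h := sum_weight_firstMoments_eq_zero_of_coclosed e A W Y hAW hWY hWY' hdiv c c
  have h0 := colSum_eq_zero_of_coclosed e A W Y hAW hWY hWY' hdiv c μ hc
  simp only [hc, ite_mul, one_mul, zero_mul, mul_ite, mul_one, mul_zero] at h
  simp only [Finset.sum_add_distrib, Finset.sum_ite_eq', Finset.mem_univ, if_true, h0, add_zero] at h
  linarith

/-- [folklore] **`transverseDipoles_antisymm_of_coclosed`**: at lattice coordinates `cμ`, `cν` of two DIFFERENT directions, the transverse dipoles of a co-closed form are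
antisymmetric: `Σ_{w∈W} cμ w·A ν w = −Σ_{w∈W} cν w·A μ w`. -/
theorem transverseDipoles_antisymm_of_coclosed [DecidableEq D] (e : D → G) (A : D → G → ℝ) (W Y : Finset G) (hAW : ∀ (κ : D) (w : G), w ∉ W → A κ w = 0)
    (hWY : ∀ w ∈ W, w ∈ Y) (hWY' : ∀ (κ : D), ∀ w ∈ W, w + e κ ∈ Y) (hdiv : ∀ y ∈ Y, ∑ κ, (A κ y - A κ (y - e κ)) = 0)
    (cμ cν : G →+ ℝ) (μ ν : D) (hμν : μ ≠ ν) (hcμ : ∀ κ, cμ (e κ) = if κ = μ then 1 else 0) (hcν : ∀ κ, cν (e κ) = if κ = ν then 1 else 0) :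
    ∑ w ∈ W, cμ w * A ν w = -∑ w ∈ W, cν w * A μ w := by
  have h := sum_weight_firstMoments_eq_zero_of_coclosed e A W Y hAW hWY hWY' hdiv cμ cν
  simp only [hcμ, hcν, ite_mul, one_mul, zero_mul, mul_ite, mul_one, mul_zero] at h
  simp only [Finset.sum_add_distrib, Finset.sum_ite_eq', Finset.mem_univ, if_true] at h
  rw [if_neg (fun h' => hμν h'.symm), add_zero] at h
  linarith

/-! ## §3 Reflections: even components have no dipole along the flipped coordinate -/

omit [Fintype D] [AddCommGroup G] [DecidableEq G] in
/-- [folklore] **`firstMoment_eq_zero_of_reflect`**: if a bijection `R` of the lattice preserves the window, leaves the component `A κ` invariant and FLIPS the weight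
affinely (`c (R w) = k − c w`), then `2·Σ_{w∈W} c w·A κ w = k·Σ_{w∈W} A κ w` — so the dipole vanishes with the column sum. -/
theorem firstMoment_eq_zero_of_reflect (A : D → G → ℝ) (W : Finset G) (R : G ≃ G) (hRW : ∀ w, w ∈ W ↔ R w ∈ W) (κ : D) (hA : ∀ w, A κ (R w) = A κ w)
    (c : G → ℝ) (k : ℝ) (hc : ∀ w, c (R w) = k - c w) (h0 : ∑ w ∈ W, A κ w = 0) :
    ∑ w ∈ W, c w * A κ w = 0 := by
  have h : ∑ w ∈ W, c w * A κ w = ∑ w ∈ W, (k - c w) * A κ w :=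
    Finset.sum_equiv R hRW fun w _ => by rw [hc, hA, sub_sub_cancel]
  have h2 : ∑ w ∈ W, (k - c w) * A κ w = k * ∑ w ∈ W, A κ w - ∑ w ∈ W, c w * A κ w := by
    rw [Finset.mul_sum, ← Finset.sum_sub_distrib]
    exact Finset.sum_congr rfl fun w _ => by ring
  rw [h2, h0, mul_zero, zero_sub] at h
  linarith

/-- [folklore] **`dipoles_eq_zero_of_coclosed_of_reflect` — THE PACKAGE**: a co-closed lattice 1-form supported in `W` (source direction `ν`), with lattice coordinates
`c ρ` (`c ρ (e κ) = [κ = ρ]`) and, for every direction `ρ ≠ ν`, a window-preserving bijection `R ρ` that flips `c ρ` affinely and leaves every component `κ ≠ ρ`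
invariant, has NO DIPOLE AT ALL: `Σ_{w∈W} c ρ w·A κ w = 0` for every `(ρ, κ)`. -/
theorem dipoles_eq_zero_of_coclosed_of_reflect [DecidableEq D] (e : D → G) (A : D → G → ℝ) (W Y : Finset G)
    (hAW : ∀ (κ : D) (w : G), w ∉ W → A κ w = 0) (hWY : ∀ w ∈ W, w ∈ Y) (hWY' : ∀ (κ : D), ∀ w ∈ W, w + e κ ∈ Y)
    (hdiv : ∀ y ∈ Y, ∑ κ, (A κ y - A κ (y - e κ)) = 0)
    (c : D → G →+ ℝ) (hc : ∀ ρ κ, c ρ (e κ) = if κ = ρ then 1 else 0) (ν : D)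
    (R : D → G ≃ G) (hRW : ∀ ρ, ρ ≠ ν → ∀ w, w ∈ W ↔ R ρ w ∈ W) (hRA : ∀ ρ, ρ ≠ ν → ∀ κ, κ ≠ ρ → ∀ w, A κ (R ρ w) = A κ w)
    (k : D → ℝ) (hRc : ∀ ρ, ρ ≠ ν → ∀ w, c ρ (R ρ w) = k ρ - c ρ w) (ρ κ : D) :
    ∑ w ∈ W, c ρ w * A κ w = 0 := by
  by_cases hρκ : κ = ρ
  · subst hρκ
    exact longitudinalDipole_eq_zero_of_coclosed e A W Y hAW hWY hWY' hdiv (c κ) κ (hc κ)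
  · by_cases hρν : ρ = ν
    · -- moment along the source direction of a transverse component: antisymmetry + the reflection in `κ`
      have hκν : κ ≠ ν := fun h => hρκ (h.trans hρν.symm)
      rw [transverseDipoles_antisymm_of_coclosed e A W Y hAW hWY hWY' hdiv (c ρ) (c κ) ρ κ (Ne.symm hρκ) (hc ρ) (hc κ), neg_eq_zero]
      exact firstMoment_eq_zero_of_reflect A W (R κ) (hRW κ hκν) ρ (hRA κ hκν ρ (Ne.symm hρκ)) (c κ) (k κ) (hRc κ hκν)
        (colSum_eq_zero_of_coclosed e A W Y hAW hWY hWY' hdiv (c ρ) ρ (hc ρ))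
    · exact firstMoment_eq_zero_of_reflect A W (R ρ) (hRW ρ hρν) κ (hRA ρ hρν κ hρκ) (c ρ) (k ρ) (hRc ρ hρν)
        (colSum_eq_zero_of_coclosed e A W Y hAW hWY hWY' hdiv (c κ) κ (hc κ))

/-! ## §4 Junction to PART 41: no door-pairing moments when the read-out column has no moments -/

section Junction

variable {V : Type*} [AddCommGroup V] [Module ℝ V]

/-- [folklore] **`latticeFirstMoment_symPairing_eq_zero_of_colSums_eq_zero`**: under PART 41's `hΘ` AND `hS0` the lattice first moment of the door pairing vanishes
for EVERY source pair `(μ, ν)` and every additive weight (PART 41 §3's right side is `M0Ŝ·M1τ − M0Ŝ·M1τ`). -/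
theorem latticeFirstMoment_symPairing_eq_zero_of_colSums_eq_zero (W Z : Finset G) (hZ : ∀ y ∈ W, ∀ w ∈ W, y - w ∈ Z)
    (S : D → G → D → G → ℝ) (tau : D → G → V →ₗ[ℝ] ℝ) (lam : D → G → V)
    (hS : ∀ (ν : D) (z : G) (κ : D) (y : G), S ν z κ y = S ν 0 κ (y - z))
    (hτ : ∀ (κ : D) (y : G) (μ : D) (z : G), tau κ y (lam μ z) = tau κ (y - z) (lam μ 0))
    (hSW : ∀ (ν κ : D) (w : G), w ∉ W → S ν 0 κ w = 0) (hτW : ∀ (κ μ : D) (w : G), w ∉ W → tau κ w (lam μ 0) = 0)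
    (hΘ : ∀ (κ μ : D), ∑ y ∈ W, tau κ y (lam μ 0) = 0) (hS0 : ∀ (ν κ : D), ∑ w ∈ W, S ν 0 κ w = 0) (c : G →+ ℝ) (μ ν : D) :
    ∑ z ∈ Z, c z * ∑ κ, ∑ y ∈ W, (S ν z κ y * tau κ y (lam μ 0) + S μ 0 κ y * tau κ y (lam ν z)) = 0 := by
  rw [latticeFirstMoment_symPairing_eq_of_colSum_eq_zero W Z hZ S tau lam hS hτ hSW hτW hΘ c μ ν]
  exact Finset.sum_eq_zero fun κ _ => by rw [hS0 ν κ, hS0 μ κ, zero_mul, zero_mul, sub_self]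

/-- [folklore] **`latticeSecondMoment_symPairing_eq_zero_of_dipoles_eq_zero` — NO SECOND MOMENT AT ALL**: under `hΘ`, `hS0` and VANISHING READ-OUT DIPOLES for the two
weights (`hS1 : Σ_w c w·S ν 0 κ w = 0`, `hS1' : Σ_w c′ w·S ν 0 κ w = 0`, all `ν κ` — §3's package), the lattice second moment of the door pairing against `c·c′` vanishes
for EVERY source pair — the (1.22) read-out line included. -/
theorem latticeSecondMoment_symPairing_eq_zero_of_dipoles_eq_zero (W Z : Finset G) (hZ : ∀ y ∈ W, ∀ w ∈ W, y - w ∈ Z)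
    (S : D → G → D → G → ℝ) (tau : D → G → V →ₗ[ℝ] ℝ) (lam : D → G → V)
    (hS : ∀ (ν : D) (z : G) (κ : D) (y : G), S ν z κ y = S ν 0 κ (y - z))
    (hτ : ∀ (κ : D) (y : G) (μ : D) (z : G), tau κ y (lam μ z) = tau κ (y - z) (lam μ 0))
    (hSW : ∀ (ν κ : D) (w : G), w ∉ W → S ν 0 κ w = 0) (hτW : ∀ (κ μ : D) (w : G), w ∉ W → tau κ w (lam μ 0) = 0)
    (hΘ : ∀ (κ μ : D), ∑ y ∈ W, tau κ y (lam μ 0) = 0) (hS0 : ∀ (ν κ : D), ∑ w ∈ W, S ν 0 κ w = 0) (c c' : G →+ ℝ)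
    (hS1 : ∀ (ν κ : D), ∑ w ∈ W, c w * S ν 0 κ w = 0) (hS1' : ∀ (ν κ : D), ∑ w ∈ W, c' w * S ν 0 κ w = 0) (μ ν : D) :
    ∑ z ∈ Z, (c z * c' z) * ∑ κ, ∑ y ∈ W, (S ν z κ y * tau κ y (lam μ 0) + S μ 0 κ y * tau κ y (lam ν z)) = 0 := by
  rw [latticeSecondMoment_symPairing_eq_of_colSums_eq_zero W Z hZ S tau lam hS hτ hSW hτW hΘ hS0 c c' μ ν, neg_eq_zero]
  exact Finset.sum_eq_zero fun κ _ => by rw [hS1 ν κ, hS1' ν κ, hS1 μ κ, hS1' μ κ]; ring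

/-- [folklore] **`hasSum_firstMoment_symPairing_of_colSums_eq_zero`** — an4's `hD1` SHAPE, every source pair: `HasSum (z ↦ c z·X((μ,0),(ν,z))) 0` under `hΘ ∧ hS0`. -/
theorem hasSum_firstMoment_symPairing_of_colSums_eq_zero (W Z : Finset G) (hZ : ∀ y ∈ W, ∀ w ∈ W, y - w ∈ Z)
    (S : D → G → D → G → ℝ) (tau : D → G → V →ₗ[ℝ] ℝ) (lam : D → G → V)
    (hS : ∀ (ν : D) (z : G) (κ : D) (y : G), S ν z κ y = S ν 0 κ (y - z))
    (hτ : ∀ (κ : D) (y : G) (μ : D) (z : G), tau κ y (lam μ z) = tau κ (y - z) (lam μ 0))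
    (hSW : ∀ (ν κ : D) (w : G), w ∉ W → S ν 0 κ w = 0) (hτW : ∀ (κ μ : D) (w : G), w ∉ W → tau κ w (lam μ 0) = 0)
    (hΘ : ∀ (κ μ : D), ∑ y ∈ W, tau κ y (lam μ 0) = 0) (hS0 : ∀ (ν κ : D), ∑ w ∈ W, S ν 0 κ w = 0) (c : G →+ ℝ) (μ ν : D) :
    HasSum (fun z : G => c z * ∑ κ, ∑ y ∈ W, (S ν z κ y * tau κ y (lam μ 0) + S μ 0 κ y * tau κ y (lam ν z))) 0 := by
  have h := hasSum_weighted_symPairing W Z hZ S tau lam hS hτ hSW hτW c μ ν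
  rwa [latticeFirstMoment_symPairing_eq_zero_of_colSums_eq_zero W Z hZ S tau lam hS hτ hSW hτW hΘ hS0 c μ ν] at h

/-- [folklore] **`hasSum_secondMoment_symPairing_of_dipoles_eq_zero`** — an4's `hD2`∕`hDF` SHAPE, every source pair and component:
`HasSum (z ↦ c z·c′ z·X((μ,0),(ν,z))) 0` under `hΘ ∧ hS0 ∧` vanishing read-out dipoles. -/
theorem hasSum_secondMoment_symPairing_of_dipoles_eq_zero (W Z : Finset G) (hZ : ∀ y ∈ W, ∀ w ∈ W, y - w ∈ Z)
    (S : D → G → D → G → ℝ) (tau : D → G → V →ₗ[ℝ] ℝ) (lam : D → G → V)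
    (hS : ∀ (ν : D) (z : G) (κ : D) (y : G), S ν z κ y = S ν 0 κ (y - z))
    (hτ : ∀ (κ : D) (y : G) (μ : D) (z : G), tau κ y (lam μ z) = tau κ (y - z) (lam μ 0))
    (hSW : ∀ (ν κ : D) (w : G), w ∉ W → S ν 0 κ w = 0) (hτW : ∀ (κ μ : D) (w : G), w ∉ W → tau κ w (lam μ 0) = 0)
    (hΘ : ∀ (κ μ : D), ∑ y ∈ W, tau κ y (lam μ 0) = 0) (hS0 : ∀ (ν κ : D), ∑ w ∈ W, S ν 0 κ w = 0) (c c' : G →+ ℝ)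
    (hS1 : ∀ (ν κ : D), ∑ w ∈ W, c w * S ν 0 κ w = 0) (hS1' : ∀ (ν κ : D), ∑ w ∈ W, c' w * S ν 0 κ w = 0) (μ ν : D) :
    HasSum (fun z : G => (c z * c' z) * ∑ κ, ∑ y ∈ W, (S ν z κ y * tau κ y (lam μ 0) + S μ 0 κ y * tau κ y (lam ν z))) 0 := by
  have h := hasSum_weighted_symPairing W Z hZ S tau lam hS hτ hSW hτW (fun z => c z * c' z) μ ν
  rwa [latticeSecondMoment_symPairing_eq_zero_of_dipoles_eq_zero W Z hZ S tau lam hS hτ hSW hτW hΘ hS0 c c' hS1 hS1' μ ν] at h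

end Junction

end Summit.QuantumFields.BalabanUV.Beta.FP.TowerK2bDoorReadoutMoments

end
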